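import Literature.AnabelianGeometry.EtaleTheta.SettingModelChiMuTwo
import Literature.AnabelianGeometry.EtaleTheta.SettingModelChiKummerDataCusp
import HarnessLib

/-!
# The Def. 1.7 layer of [EtTh] §1 over the χ-twisted model WITH A CUSP, file F8c: `MuTwoSetting.modelχ′ p`

S. Mochizuki, *The étale theta function and its Frobenioid-theoretic manifestations*, Publ. RIMS **45** (2009)
[EtTh], §1, Def. 1.7 p. 27 ("`K = K̈`", "`C^log = X^log/±1`", "`Ẍ^log → X^log` … of degree 4", "`ε_μ`", "`ε_±`",
"`ε_Z`"), p. 13 ("any decomposition group of a cusp of `Y^log`") [cite: MochizukiEtTh2009, Def 1.7 p.27].  Layer L2 of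
the abc-iut cell, R78 cluster (CLAIM by line 10:5xZ per L2-lead R226, cusp lineage of abc-iut-w5-d029; first refusal
abc-iut-f-113 g3): abc-iut-f-113's F8 record `MuTwoSetting.modelχ p` (`SettingModelChiMuTwo`: `Π^tp_C := Π^tp_X × ℤ/2`,
`Π^tp_Ẍ := Ker parityχ`, `ε_μ := b`, `ε_± :=` the `ℤ/2` generator, admissible `ε_Z := a`) TRANSCRIBED over this seat's
cusped root `ThetaSetting.modelχ′ p` (F5c `SettingModelChiThetaCusp`, p433756: the SAME `Π^tp_X = Γ ⋊_χ G_{ℚ_p}`, theta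
quotients and coverings, plus ONE synthetic cusp with decomposition group `b^Ẑ ⋊ G_{ℚ_p}`).  Every field is F8's
verbatim; the carriers agree definitionally:

* `gtpYdd_modelχ'_le_Xddχ` (= F8's clause, same subgroups); **`MuTwoSetting.modelχ′ p : MuTwoSetting p`** with
  `toThetaSetting := ThetaSetting.modelχ′ p`; `modelχ'_toThetaSetting`, `modelχ'_GtpC_inclX_GtpXdd`, `modelχ'_dotX_dotC`
  (`rfl` against F8);
* `MuTwoSetting.modelχ'_isEtThOrigin`, `modelχ'_compat`, **`modelχ'_isAdmissibleEpsZ`** (F8's `epsZχ`);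
* the cusp at the MuTwo level: `exists_isCusp_muTwo_modelχ'`, `decomp_muTwo_modelχ'_eq` (= `cuspDecompχ p`);
* headline `MuTwoSetting.exists_isEtThOrigin_and_isAdmissibleEpsZ_and_isCusp_and_nonempty_kummerData` — a
  `MuTwoSetting` with the guard, `Compat`, an admissible `ε_Z`, A CUSP and Kummer data (abc-iut-w5-d171's
  `nonempty_kummerData_modelχ'`, p435106): the parent record for the cusp-indexed Def. 1.9 / [GalSect] §4 vocabulary
  (`MuTwoSetting.DotCCusp`, L2-lead R226 (b1)) at a Kummer-carrying model.

HONEST LIMITS: semi-synthetic model (as F8: `Π^tp_C` is a direct product, `ε_±` central; the cusp is the Tate-twisted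
`b`-axis, `SettingModelCuspAxis`) — consistency evidence for the typed interface only; nothing of [EtTh] asserted; no
side taken on [IUTchIII] Cor. 3.12; typed ≠ proved; instantiated ≠ endorsed.  Class (b) construction (one `abbrev`
record over F8's carrier; no instance, no Prop fact; F8 / F5c untouched).
-/

noncomputable section

namespace Literature.AnabelianGeometry.EtaleTheta.SettingModel

open Literature.AnabelianGeometry.SemiGraphs
open Function

variable (p : ℕ) [Fact p.Prime]

/-- `Π^tp_Ÿ ≤ Π^tp_Ẍ` at the CUSPED χ-model (the same subgroups of the same `Π^tp_X` as at `modelχ`).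
[cite: MochizukiEtTh2009, Def 1.7 p.27] -/
theorem gtpYdd_modelχ'_le_Xddχ : (ThetaSetting.modelχ' p).GtpYdd ≤ Xddχ p := gtpYdd_modelχ_le_Xddχ p

/-- **The Def. 1.7 layer over the χ-twisted model WITH A CUSP** — abc-iut-f-113's `MuTwoSetting.modelχ p` (F8)
with `toThetaSetting := ThetaSetting.modelχ′ p` (F5c, p433756: the same `Π^tp_X = Γ ⋊_χ G_{ℚ_p}` plus ONE synthetic
cusp); every other field F8's verbatim: `Π^tp_C := Π^tp_X × ℤ/2`, `Π^tp_Ẍ := Ker parityχ`, `ε_μ := b`, `ε_± :=` the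
generator of `ℤ/2`. Consistency evidence only. [cite: MochizukiEtTh2009, Def 1.7 p.27] -/
abbrev _root_.Literature.AnabelianGeometry.EtaleTheta.MuTwoSetting.modelχ' : MuTwoSetting p where
  toThetaSetting := ThetaSetting.modelχ' p
  sqrtqX_mem_K := natCast_mem _ p
  GtpC := PiCprodχ p
  inclX := inclXχ p
  continuous_inclX := continuous_inclXχ p
  injective_inclX := fun a b h => congrArg Prod.fst h
  isOpen_range_inclX := isOpen_range_inclXχ p
  range_inclX_normal := by rw [range_inclXχ]; infer_instance
  index_range_inclX := by
    rw [range_inclXχ, Subgroup.index_prod, Subgroup.index_top, Subgroup.index_bot, one_mul]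
    show Nat.card (ZMod 2) = 2
    exact Nat.card_zmod 2
  GtpXdd := Xddχ p
  index_GtpXdd := index_Xddχ p
  map_GtpXdd_normal := by
    rw [map_inclXχ]
    haveI := Xddχ_normal p
    infer_instance
  sq_mem_GtpXdd g := by
    rw [map_inclXχ, Subgroup.mem_prod, Subgroup.mem_bot]
    refine ⟨mul_self_mem_Xddχ p g.1, ?_⟩
    show g.2 * g.2 = 1
    have h2 : ∀ t : Multiplicative (ZMod 2), t * t = 1 := by decide
    exact h2 g.2
  GtpYdd_le_GtpXdd := gtpYdd_modelχ'_le_Xddχ p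
  epsMu := inclXχ p (SemidirectProduct.inl (gfpOf (FreeGroup.of 1)))
  epsMu_mem := ⟨_, rfl⟩
  epsMu_not_mem := by
    rw [map_inclXχ]
    rintro ⟨h1, -⟩
    exact inl_gfpOf_one_not_mem_Xddχ p h1
  epsPM := (1, Multiplicative.ofAdd 1)
  epsPM_not_mem := by
    rintro ⟨y, hy⟩
    have h2 : ((inclXχ p) y).2 = Multiplicative.ofAdd 1 := congrArg Prod.snd hy
    have h1 : ((inclXχ p) y).2 = 1 := rfl
    rw [h1] at h2
    exact absurd h2 (by decide)

/-- The cusped Def. 1.7 layer sits over the cusped χ-twisted root. [cite: MochizukiEtTh2009, Def 1.7 p.27] -/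
theorem _root_.Literature.AnabelianGeometry.EtaleTheta.MuTwoSetting.modelχ'_toThetaSetting :
    (MuTwoSetting.modelχ' p).toThetaSetting = ThetaSetting.modelχ' p := rfl

/-- `Π^tp_C`, `Π^tp_X ↪ Π^tp_C`, `Π^tp_Ẍ`, `ε_μ`, `ε_±` of the cusped layer are F8's (`rfl`).
[cite: MochizukiEtTh2009, Def 1.7 p.27] -/
theorem _root_.Literature.AnabelianGeometry.EtaleTheta.MuTwoSetting.modelχ'_GtpC_inclX_GtpXdd :
    (MuTwoSetting.modelχ' p).GtpC = (MuTwoSetting.modelχ p).GtpC ∧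
      (MuTwoSetting.modelχ' p).inclX = (MuTwoSetting.modelχ p).inclX ∧
      (MuTwoSetting.modelχ' p).GtpXdd = (MuTwoSetting.modelχ p).GtpXdd ∧
      (MuTwoSetting.modelχ' p).epsMu = (MuTwoSetting.modelχ p).epsMu ∧
      (MuTwoSetting.modelχ' p).epsPM = (MuTwoSetting.modelχ p).epsPM :=
  ⟨rfl, rfl, rfl, rfl, rfl⟩

/-- … hence satisfies the guard `IsEtThOrigin`. [cite: MochizukiEtTh2009, §1 p.12] -/
theorem _root_.Literature.AnabelianGeometry.EtaleTheta.MuTwoSetting.modelχ'_isEtThOrigin :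
    (MuTwoSetting.modelχ' p).toThetaSetting.IsEtThOrigin :=
  ThetaSetting.modelχ'_isEtThOrigin p

/-- … and the §1 containments `Compat`. [cite: MochizukiEtTh2009, Prop 1.5 p.22] -/
theorem _root_.Literature.AnabelianGeometry.EtaleTheta.MuTwoSetting.modelχ'_compat :
    (MuTwoSetting.modelχ' p).toThetaSetting.Compat :=
  (ThetaSetting.modelχ' p).compat

/-- **`ε_Z := a` is an admissible choice** at the cusped χ-model (F8's `epsZχ`, same `Π^tp_C`).
[cite: MochizukiEtTh2009, Def 1.7 p.27] -/
theorem _root_.Literature.AnabelianGeometry.EtaleTheta.MuTwoSetting.modelχ'_isAdmissibleEpsZ :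
    (MuTwoSetting.modelχ' p).IsAdmissibleEpsZ (epsZχ p) :=
  MuTwoSetting.modelχ_isAdmissibleEpsZ p

/-- `Π^tp_Ẋ`, `Π^tp_Ċ` of the cusped layer are F8's (same `Π^tp_C`, `Π^tp_Ẍ`, `ε`'s). [cite: MochizukiEtTh2009, Def 1.7 p.27] -/
theorem _root_.Literature.AnabelianGeometry.EtaleTheta.MuTwoSetting.modelχ'_dotX_dotC (εZ : PiCprodχ p) :
    (MuTwoSetting.modelχ' p).dotX εZ = (MuTwoSetting.modelχ p).dotX εZ ∧
      (MuTwoSetting.modelχ' p).dotC εZ = (MuTwoSetting.modelχ p).dotC εZ :=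
  ⟨rfl, rfl⟩

/-- **The cusped Def. 1.7 layer HAS A CUSP** (`Pt = Unit`, every point a cusp, decomposition group
`b^Ẑ ⋊ G_{ℚ_p}`). [cite: MochizukiEtTh2009, §1 p.13] -/
theorem exists_isCusp_muTwo_modelχ' :
    ∃ x : (MuTwoSetting.modelχ' p).Pt, (MuTwoSetting.modelχ' p).IsCusp x :=
  ⟨(), trivial⟩

/-- The decomposition group of the cusp of the Def. 1.7 layer is `cuspDecompχ p = b^Ẑ ⋊ G_{ℚ_p} ≤ Π^tp_X`.
[cite: MochizukiEtTh2009, §1 p.13] -/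
theorem decomp_muTwo_modelχ'_eq (x : (MuTwoSetting.modelχ' p).Pt) :
    (MuTwoSetting.modelχ' p).decomp x = cuspDecompχ p := rfl

/-- **Joint satisfiability at a Kummer-carrying model WITH A CUSP**: there is a `MuTwoSetting p` whose theta setting
satisfies the guard `IsEtThOrigin` and `Compat`, which admits an admissible `ε_Z`, HAS A CUSP, and carries Kummer data
(abc-iut-w5-d171's `nonempty_kummerData_modelχ'`, p435106) — the domain of the Def. 1.7 / 1.9 / Thm. 1.10 statements is
inhabited at the Kummer level by a model in which the cusp-indexed [GalSect]/Def. 1.9 vocabulary is not vacuous by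
emptiness of `Pt`. [cite: MochizukiEtTh2009, Def 1.7 p.27] -/
theorem _root_.Literature.AnabelianGeometry.EtaleTheta.MuTwoSetting.exists_isEtThOrigin_and_isAdmissibleEpsZ_and_isCusp_and_nonempty_kummerData :
    ∃ M : MuTwoSetting p, M.toThetaSetting.IsEtThOrigin ∧ M.toThetaSetting.Compat ∧
      (∃ εZ : M.GtpC, M.IsAdmissibleEpsZ εZ) ∧ (∃ x : M.Pt, M.IsCusp x) ∧ Nonempty M.toThetaSetting.KummerData :=
  ⟨MuTwoSetting.modelχ' p, MuTwoSetting.modelχ'_isEtThOrigin p, MuTwoSetting.modelχ'_compat p,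
    ⟨_, MuTwoSetting.modelχ'_isAdmissibleEpsZ p⟩, ⟨(), trivial⟩, nonempty_kummerData_modelχ' p⟩

end Literature.AnabelianGeometry.EtaleTheta.SettingModel

end

-- re-land (abc-iut-w5-d029 g5, 2026-08-26T11:39:26Z): byte-identical declarations; STRANDED-ACCEPT remedy — p439747 ACCEPTED 11:02:50Z but no olean on the hub (remote:stale:unbuilt), children GalSectDotCCuspDecompCriterion wait on it.
-- no side taken on [IUTchIII] Cor. 3.12.
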